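import Mathlib
import HarnessLib
import Summits.HubbardSuperconductivity.HubbardSuperconductivity.Theorems.KLProgrammeH10TwoPointLimitKlAnisoOnUmklappCountWideTol
import Summits.HubbardSuperconductivity.HubbardSuperconductivity.Theorems.KLProgrammeKLRegimeSplitOnWindow

/-!
# Route `KLProgramme` — K3 engine (stmt-HubbardSuperconductivity-20437), stub (b) (ℓ)/(I2), located item «ON-CLASS-KB» (U):
# the WIDE on-class row at an arbitrary class tolerance, in the K3 stubs' binders (FrameOK frames, KL regime, covariance window `klWindowC`)

Cell gate-hubbard-kl, seat p4 g13.  `card_relCount_prescribed_onUmklapp_klAniso_le_frame_wide_tol` (`…KlAnisoOnUmklappCountWideTol`) transported to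
admissible frames exactly as `…KlAnisoOnUmklappCountWindow` transports the single-`Θ` row: the frame's `C²` size `A(R,U,c)` is below the geometric threshold
`κ` once `c ≤ c₃(R)`, `U ≤ U₀(R)` (`frame_thresholds`, `norm_iteratedFDeriv_frameShift_le_of_frameOK_regime`).
* `card_relCount_prescribed_onUmklapp_klAniso_le_frameOK_wide_tol` — level window `[μ₁, μ₂]`;
* **`card_relCount_prescribed_onUmklapp_klAniso_le_window_wide_tol`** — `μ ∈ klWindowC`.
PROVED; no definitions, no named facts; nothing here asserts anything about the model or superconductivity.
References: BGM 2006 App. A3 [cite: BenfattoGiulianiMastropietro2006]; BGM 2003 §3.1 Lemma 3.1 (4.3), §7.4 [cite: BenfattoGiulianiMastropietro2003].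
-/

noncomputable section

namespace Summit.HubbardSuperconductivity.HubbardSuperconductivity.Theorems.PerturbedFermiCurve

set_option linter.dupNamespace false -- summit = problem name (single-conjunct summit), D-0017

open Classical
open Real Set Finset
open Literature.MathematicalPhysics.QuantumLattice Literature.MathematicalPhysics.QuantumLattice.BandSectorCounting
open Literature.MathematicalPhysics.QuantumLattice.FermiRG Literature.MathematicalPhysics.QuantumLattice.FermiRG.BGM2003
open Literature.MathematicalPhysics.QuantumLattice.FermiRG.BGM2006AppA (signedMom_mem_sSector2003 sSector2003_subset_of_le)
open Literature.Probability.LatticeModels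
open Summit.HubbardSuperconductivity.HubbardSuperconductivity.Theorems.DispersionFlow
open Summit.HubbardSuperconductivity.HubbardSuperconductivity.Theorems.KLRegimeSplit
open Summit.HubbardSuperconductivity.HubbardSuperconductivity.Theorems.KLProgrammeLegKernels
open Summit.HubbardSuperconductivity.HubbardSuperconductivity.Theorems.TorusFourierL2

/-- **The WIDE on-class relative count at an arbitrary class tolerance, ON EVERY ADMISSIBLE FRAME IN THE KL REGIME** (`C`, the geometric constants and
`k₀` before `Rc`). [cite: BenfattoGiulianiMastropietro2006, App. A3 Lemma A3.1; BenfattoGiulianiMastropietro2003, §3.1 Lemma 3.1 (4.3), §7.4] -/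
theorem card_relCount_prescribed_onUmklapp_klAniso_le_frameOK_wide_tol :
    ∀ μ₁ μ₂ : ℝ, -4 < μ₁ - 4 * klE0 → μ₁ ≤ μ₂ → μ₂ + 4 * klE0 < 0 →
      ∃ C : ℝ, 0 < C ∧
      ∃ c₂ cb K₁ K₂ c₀ c₂' : ℝ, 0 ≤ c₂ ∧ 0 < cb ∧ 2 + c₂ ≤ K₁ ∧ 0 < K₂ ∧ 0 < c₀ ∧ 0 < c₂' ∧ ∃ k₀ : ℕ,
      ∀ Rc : RenConsts, (∀ j, 0 ≤ Rc.Gfr j) →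
      ∃ c₃ : ℝ, 0 < c₃ ∧ ∃ U₀ : ℝ, 0 < U₀ ∧
      ∀ c : ℝ, 0 < c → c ≤ c₃ → ∀ U : ℝ, 0 < U → U ≤ U₀ → ∀ β : ℝ, klBetaMin ≤ β → β ≤ Real.exp (c / U ^ 2) →
      ∀ μ ∈ Set.Icc μ₁ μ₂, ∀ (ν : ℝ) (K : TrigPolyC4v), FrameOK Rc U (nScales β) ν K →
      ∀ (L M : ℕ) [NeZero L] (m k J' : ℕ), k₀ ≤ k → k ≤ J' → 3 ≤ m →
      ∀ (A'' : Finset (Fin (m + 1) → SectorLeg (sectorCount J'))),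
        A'' ⊆ bgmSectorSet L M (klAnisoFamily L M β μ K klE0 J') (m + 1) →
      ∀ (E : Finset (Fin (m + 1))) (τ'' : Fin (m + 1) → SectorLeg (sectorCount J')) (p : Fin (m + 1)), p ∈ E →
      ∀ σ' : Fin (m + 1) → SectorLeg (sectorCount k), ∀ (G₀ : Fin 2 → ℤ) (C' : ℝ),
      (∀ j : Fin 2, |∑ i, (if (σ' i).2 = 0 then klFermiPoint μ K (sectorCenter k (σ' i).1.1) j
              else -klFermiPoint μ K (sectorCenter k (σ' i).1.1) j) - 2 * π * (G₀ j : ℝ)| ≤ ((m : ℝ) + 1) * C' * sectorWidth k) →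
      ((m : ℝ) + 1) * (C + C') * sectorWidth k < 2 * π →
      ∀ Ψ₀ : ℝ, 0 ≤ Ψ₀ →
      (∀ i : Fin (m + 1), pairAngle
          (sectorCenter k (if (σ' p).2 = 0 then ((σ' p).1.1 : ℕ) else
            if ((σ' p).1.1 : ℕ) < 2 ^ k then ((σ' p).1.1 : ℕ) + 2 ^ k else ((σ' p).1.1 : ℕ) - 2 ^ k))
          (sectorCenter k (if (σ' i).2 = 0 then ((σ' i).1.1 : ℕ) else
            if ((σ' i).1.1 : ℕ) < 2 ^ k then ((σ' i).1.1 : ℕ) + 2 ^ k else ((σ' i).1.1 : ℕ) - 2 ^ k)) ≤ Ψ₀) →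
      ∀ (Θ LΨ Bfib : ℝ), LΨ = (m + 1 : ℕ) + c₂ * (Ψ₀ + 5 * sectorWidth k) / (K₁ * Θ) → (2 : ℝ) ^ (-(J' : ℤ)) ≤ Θ →
        cb * (2 : ℝ) ^ (-(J' : ℤ)) ≤ Θ → K₂ * LΨ * (cb * (2 : ℝ) ^ (-(J' : ℤ))) ≤ c₂' * Θ →
        max ((2 * ((2 * c₀ * K₂ * cb / π + 1) * LΨ)) ^ 2) (4 * cb ^ 2 * K₂ ^ 2 / 1 ^ 2 * LΨ ^ 2) ≤ Bfib →
      ∀ (i₀ j₀ : Fin (m + 1)), i₀ ≠ p → j₀ ≠ p →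
      Θ + 5 * sectorWidth k < pairAngle
          (sectorCenter k (if (σ' i₀).2 = 0 then ((σ' i₀).1.1 : ℕ) else
            if ((σ' i₀).1.1 : ℕ) < 2 ^ k then ((σ' i₀).1.1 : ℕ) + 2 ^ k else ((σ' i₀).1.1 : ℕ) - 2 ^ k))
          (sectorCenter k (if (σ' j₀).2 = 0 then ((σ' j₀).1.1 : ℕ) else
            if ((σ' j₀).1.1 : ℕ) < 2 ^ k then ((σ' j₀).1.1 : ℕ) + 2 ^ k else ((σ' j₀).1.1 : ℕ) - 2 ^ k)) →
      ((((A''.filter fun σ'' => (∀ e ∈ E, σ'' e = τ'' e) ∧ ∀ i,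
          (∃ q : FreqMomentum L M, klAnisoFamily L M β μ K klE0 J' (σ'' i).1.1 q ≠ 0 ∧
            bgmFatMultiplier L M klE0 β (nambuXiCT L μ K) k (σ' i).1.1 q ≠ 0) ∧
          (σ' i).1.2 = (σ'' i).1.2 ∧ (σ' i).2 = (σ'' i).2).card : ℕ) : ℝ)) ≤
        (5 : ℝ) ^ (m + 1) * ((m + 1 : ℕ) ^ 2 * (Bfib * (3 * (2 : ℝ) ^ (J' - k)) ^ ((m + 1) - 3))) := by
  intro μ₁ μ₂ hμ₁ h12 hμ₂
  obtain ⟨κ, hκ, C, hC, c₂, cb, K₁, K₂, c₀, c₂', h1, h2, h3, h4, h5, h6, k₀, h⟩ :=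
    card_relCount_prescribed_onUmklapp_klAniso_le_frame_wide_tol μ₁ μ₂ hμ₁ h12 hμ₂
  refine ⟨C, hC, c₂, cb, K₁, K₂, c₀, c₂', h1, h2, h3, h4, h5, h6, k₀, fun Rc hR => ?_⟩
  obtain ⟨c₃, hc₃, U₀, hU₀, hthr⟩ := frame_thresholds hR hκ
  refine ⟨c₃, hc₃, U₀, hU₀, ?_⟩
  intro c hc hcle U hU hUle β hβmin hβc μ hμ ν K hK L M _ m k J' hk₀ hkJ hm A'' hA'' E τ'' p hp σ' G₀ C' hon hsmall Ψ₀ hΨ₀ hwedge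
    Θ LΨ Bfib hLΨ hΘt hΘδ hΘη hBfib i₀ j₀ hi₀ hj₀ hfar
  exact h K _ (fun q j hj => norm_iteratedFDeriv_frameShift_le_of_frameOK_regime hR hc.le hβmin hβc hK q hj)
    (hthr c U hc.le hcle hU hUle) μ hμ L M β m k J' hk₀ hkJ hm A'' hA'' E τ'' p hp σ' G₀ C' hon hsmall Ψ₀ hΨ₀ hwedge Θ LΨ Bfib hLΨ hΘt hΘδ hΘη hBfib
    i₀ j₀ hi₀ hj₀ hfar

/-- **The WIDE on-class relative count at an arbitrary class tolerance, on the covariance window `klWindowC`** (constants absolute; regime thresholds per `Rc`).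
[cite: BenfattoGiulianiMastropietro2006, App. A3 Lemma A3.1; BenfattoGiulianiMastropietro2003, §3.1 Lemma 3.1 (4.3), §7.4] -/
theorem card_relCount_prescribed_onUmklapp_klAniso_le_window_wide_tol :
      ∃ C : ℝ, 0 < C ∧
      ∃ c₂ cb K₁ K₂ c₀ c₂' : ℝ, 0 ≤ c₂ ∧ 0 < cb ∧ 2 + c₂ ≤ K₁ ∧ 0 < K₂ ∧ 0 < c₀ ∧ 0 < c₂' ∧ ∃ k₀ : ℕ,
      ∀ Rc : RenConsts, (∀ j, 0 ≤ Rc.Gfr j) →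
      ∃ c₃ : ℝ, 0 < c₃ ∧ ∃ U₀ : ℝ, 0 < U₀ ∧
      ∀ c : ℝ, 0 < c → c ≤ c₃ → ∀ U : ℝ, 0 < U → U ≤ U₀ → ∀ β : ℝ, klBetaMin ≤ β → β ≤ Real.exp (c / U ^ 2) →
      ∀ μ ∈ klWindowC, ∀ (ν : ℝ) (K : TrigPolyC4v), FrameOK Rc U (nScales β) ν K →
      ∀ (L M : ℕ) [NeZero L] (m k J' : ℕ), k₀ ≤ k → k ≤ J' → 3 ≤ m →
      ∀ (A'' : Finset (Fin (m + 1) → SectorLeg (sectorCount J'))),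
        A'' ⊆ bgmSectorSet L M (klAnisoFamily L M β μ K klE0 J') (m + 1) →
      ∀ (E : Finset (Fin (m + 1))) (τ'' : Fin (m + 1) → SectorLeg (sectorCount J')) (p : Fin (m + 1)), p ∈ E →
      ∀ σ' : Fin (m + 1) → SectorLeg (sectorCount k), ∀ (G₀ : Fin 2 → ℤ) (C' : ℝ),
      (∀ j : Fin 2, |∑ i, (if (σ' i).2 = 0 then klFermiPoint μ K (sectorCenter k (σ' i).1.1) j
              else -klFermiPoint μ K (sectorCenter k (σ' i).1.1) j) - 2 * π * (G₀ j : ℝ)| ≤ ((m : ℝ) + 1) * C' * sectorWidth k) →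
      ((m : ℝ) + 1) * (C + C') * sectorWidth k < 2 * π →
      ∀ Ψ₀ : ℝ, 0 ≤ Ψ₀ →
      (∀ i : Fin (m + 1), pairAngle
          (sectorCenter k (if (σ' p).2 = 0 then ((σ' p).1.1 : ℕ) else
            if ((σ' p).1.1 : ℕ) < 2 ^ k then ((σ' p).1.1 : ℕ) + 2 ^ k else ((σ' p).1.1 : ℕ) - 2 ^ k))
          (sectorCenter k (if (σ' i).2 = 0 then ((σ' i).1.1 : ℕ) else
            if ((σ' i).1.1 : ℕ) < 2 ^ k then ((σ' i).1.1 : ℕ) + 2 ^ k else ((σ' i).1.1 : ℕ) - 2 ^ k)) ≤ Ψ₀) →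
      ∀ (Θ LΨ Bfib : ℝ), LΨ = (m + 1 : ℕ) + c₂ * (Ψ₀ + 5 * sectorWidth k) / (K₁ * Θ) → (2 : ℝ) ^ (-(J' : ℤ)) ≤ Θ →
        cb * (2 : ℝ) ^ (-(J' : ℤ)) ≤ Θ → K₂ * LΨ * (cb * (2 : ℝ) ^ (-(J' : ℤ))) ≤ c₂' * Θ →
        max ((2 * ((2 * c₀ * K₂ * cb / π + 1) * LΨ)) ^ 2) (4 * cb ^ 2 * K₂ ^ 2 / 1 ^ 2 * LΨ ^ 2) ≤ Bfib →
      ∀ (i₀ j₀ : Fin (m + 1)), i₀ ≠ p → j₀ ≠ p →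
      Θ + 5 * sectorWidth k < pairAngle
          (sectorCenter k (if (σ' i₀).2 = 0 then ((σ' i₀).1.1 : ℕ) else
            if ((σ' i₀).1.1 : ℕ) < 2 ^ k then ((σ' i₀).1.1 : ℕ) + 2 ^ k else ((σ' i₀).1.1 : ℕ) - 2 ^ k))
          (sectorCenter k (if (σ' j₀).2 = 0 then ((σ' j₀).1.1 : ℕ) else
            if ((σ' j₀).1.1 : ℕ) < 2 ^ k then ((σ' j₀).1.1 : ℕ) + 2 ^ k else ((σ' j₀).1.1 : ℕ) - 2 ^ k)) →
      ((((A''.filter fun σ'' => (∀ e ∈ E, σ'' e = τ'' e) ∧ ∀ i,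
          (∃ q : FreqMomentum L M, klAnisoFamily L M β μ K klE0 J' (σ'' i).1.1 q ≠ 0 ∧
            bgmFatMultiplier L M klE0 β (nambuXiCT L μ K) k (σ' i).1.1 q ≠ 0) ∧
          (σ' i).1.2 = (σ'' i).1.2 ∧ (σ' i).2 = (σ'' i).2).card : ℕ) : ℝ)) ≤
        (5 : ℝ) ^ (m + 1) * ((m + 1 : ℕ) ^ 2 * (Bfib * (3 * (2 : ℝ) ^ (J' - k)) ^ ((m + 1) - 3))) :=
  card_relCount_prescribed_onUmklapp_klAniso_le_frameOK_wide_tol (-1.05) (-0.15) (by norm_num [klE0]) (by norm_num) (by norm_num [klE0])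

end Summit.HubbardSuperconductivity.HubbardSuperconductivity.Theorems.PerturbedFermiCurve

end
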